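import Mathlib
import HarnessLib

/-!
# The isolation-product criterion `(K)` for the three-point variance row, and `(3PT)` for all hub laws

Support file for crux `stmt-CriticalPhenomena-4575` (`NoHeavyLowerTail`), seat `prim-l12-p1` gen 19 (`--supports stmt-CriticalPhenomena-4575`).
Memo `run/shared/lean/prim/prim-l12/FROM-prim-l12-p1-g19-COMB-PLUS.md` §7–§8.

For a finite weighted graph with terminals `a b c` write `Q = P(sep)` (the three terminals pairwise disconnected), `A = P(c ↮ {a,b})`,
`B = P(b ↮ {a,c})`, `C = P(a ↮ {b,c})` (isolation probabilities; `Q ≤ A, B, C ≤ 1`).  Since `{a ↮ b} = {a isolated} ∪ {b isolated}` with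
intersection `sep`, the three-point variance row `(3PT)  P(a↔b)·P(a↮b) ≤ P(ab|c) + P(ac|b) + P(bc|a)` is, in these coordinates, the real
inequality `2Q − A ≤ (B + C − Q)²` (`threePoint_cells`).  The four isolation probabilities are MULTIPLICATIVE under parallel composition at
the terminals (gluing edge-disjoint pieces at `a, b, c`), which `(3PT)` itself is not.  THIS FILE proves [this work]:

* `threePoint_of_isoK`: the product-closed criterion `(K)  Q³ ≤ A²BC ∧ Q³ ≤ AB²C ∧ Q³ ≤ ABC²` (i.e. `A·B·C·min(A,B,C) ≥ Q³`) implies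
  `2Q − A ≤ (B+C−Q)²`, for all reals `0 ≤ Q ≤ A, B, C` (pure algebra: `sq_bound_of_min`, `quintic_bound`);
* `star_isoK_A/B/C`: `(K)` holds for the law of a single hub joined to `a, b, c` with probabilities `α, β, γ` (explicit polynomial identities with
  non-negative terms; equality on the face `α = 1` for `ABC² ≥ Q³`);
* `isoK_prod`: `(K)` is closed under coordinatewise products over a `Finset`;
* `threePoint_hubLaw`: consequently `2Q − A ≤ (B+C−Q)²` for the product law of any finite family of hubs — the law of the complete bipartite
  graphs `K_{3,k}` with arbitrary edge weights (the family on which every linear/inductive scheme of the memo stalls, §3, and on which the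
  law-level sharpenings `CONJ-R`, `PF1`, `(ISO2)` were refuted).

The identification of `(Q,A,B,C)(K_{3,k})` with these products (independence of the hubs' edge triples) is the percolation wrapper, kept out of this
algebraic file.  `(K)` is NOT valid for all graphs (memo §7: a 5-vertex law misses it by `6·10⁻⁵` in log scale), so this is a theorem about the hub
family and its parallel compositions with other `(K)`-pieces (terminal cut vertices, terminal edges), not a reduction of `(3PT)` in general.
-/

namespace Summit.CriticalPhenomena.PercolationContinuityZ3.Theorems.ThreePointIsoProduct

/-! ## `(3PT)` in isolation coordinates -/

/-- **Cells to isolation coordinates**: with `q+s = A`, `q+t = B`, `q+u = C`, `x = 1 − q − s − t − u`, the row `(x+s)(1−(x+s)) ≤ s+t+u` is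
`2q − A ≤ (B+C−q)²`. [this work] -/
theorem threePoint_cells {x s t u q : ℝ} (hx : x + s + t + u + q = 1) (h : 2 * q - (q + s) ≤ ((q + t) + (q + u) - q) ^ 2) :
    (x + s) * (1 - (x + s)) ≤ s + t + u := by
  have hθ : x + s = 1 - (t + u + q) := by linarith
  rw [hθ]
  nlinarith [h]

/-! ## Two polynomial bounds -/

/-- For `0 ≤ Q ≤ M ≤ X, Y`:  `X·Y·(2M−Q)² ≤ (X+Y−Q)²·M²`, i.e. `(X+Y−Q)²/(XY) ≥ (2 − Q/M)²`. [this work] -/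
theorem sq_bound_of_min {Q M X Y : ℝ} (hQ : 0 ≤ Q) (hQM : Q ≤ M) (hMX : M ≤ X) (hMY : M ≤ Y) :
    X * Y * (2 * M - Q) ^ 2 ≤ (X + Y - Q) ^ 2 * M ^ 2 := by
  have key : (X + Y - Q) ^ 2 * M ^ 2 - X * Y * (2 * M - Q) ^ 2 =
      M * (2 * M - Q) * ((X - M) + (Y - M)) * Q + M ^ 2 * ((X - M) - (Y - M)) ^ 2 +
        Q * (4 * M - Q) * ((X - M) * (Y - M)) := by ring
  have h1 : 0 ≤ X - M := sub_nonneg.2 hMX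
  have h2 : 0 ≤ Y - M := sub_nonneg.2 hMY
  have h3 : 0 ≤ 2 * M - Q := by linarith
  have h4 : 0 ≤ 4 * M - Q := by linarith
  have hM : 0 ≤ M := hQ.trans hQM
  nlinarith [key, mul_nonneg (mul_nonneg (mul_nonneg hM h3) (add_nonneg h1 h2)) hQ, mul_nonneg (sq_nonneg M) (sq_nonneg ((X - M) - (Y - M))),
    mul_nonneg (mul_nonneg hQ h4) (mul_nonneg h1 h2)]

/-- For `0 ≤ Q ≤ M`:  `M⁴(2Q−M) ≤ (2M−Q)²Q³`  (the quintic `(m−1)(m⁴−m³−m²+3m−1) ≥ 0` at `m = M/Q ≥ 1`). [this work] -/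
theorem quintic_bound {Q M : ℝ} (hQ : 0 ≤ Q) (hQM : Q ≤ M) : M ^ 4 * (2 * Q - M) ≤ (2 * M - Q) ^ 2 * Q ^ 3 := by
  have key : (2 * M - Q) ^ 2 * Q ^ 3 - M ^ 4 * (2 * Q - M) =
      (M - Q) * (Q ^ 4 + 2 * Q ^ 3 * (M - Q) + 2 * Q ^ 2 * (M - Q) ^ 2 + 3 * Q * (M - Q) ^ 3 + (M - Q) ^ 4) := by ring
  have hd : 0 ≤ M - Q := sub_nonneg.2 hQM
  have hin : 0 ≤ Q ^ 4 + 2 * Q ^ 3 * (M - Q) + 2 * Q ^ 2 * (M - Q) ^ 2 + 3 * Q * (M - Q) ^ 3 + (M - Q) ^ 4 := by positivity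
  nlinarith [key, mul_nonneg hd hin]

/-! ## The criterion `(K) ⟹ (3PT)` -/

/-- Case `A = min(A,B,C)`. [this work] -/
theorem threePoint_of_isoK_minA {Q A B C : ℝ} (hQ : 0 ≤ Q) (hQA : Q ≤ A) (hAB : A ≤ B) (hAC : A ≤ C)
    (hK : Q ^ 3 ≤ A ^ 2 * B * C) : 2 * Q - A ≤ (B + C - Q) ^ 2 := by
  by_cases hneg : 2 * Q - A ≤ 0
  · exact hneg.trans (sq_nonneg _)
  push Not at hneg
  have hQpos : 0 < Q := by
    rcases hQ.eq_or_lt with h | h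
    · exfalso; rw [← h] at hneg hQA; linarith
    · exact h
  have hApos : 0 < A := hQpos.trans_le hQA
  have h1 := sq_bound_of_min hQ hQA hAB hAC
  have h2 := quintic_bound hQ hQA
  have hBC : 0 ≤ B * C := mul_nonneg (hApos.le.trans hAB) (hApos.le.trans hAC)
  -- `A² · [A²BC(2Q−A)] ≤ A² · [(B+C−Q)² Q³]`
  have h3 : A ^ 2 * (A ^ 2 * B * C * (2 * Q - A)) ≤ A ^ 2 * ((B + C - Q) ^ 2 * Q ^ 3) := by
    have e1 : A ^ 2 * (A ^ 2 * B * C * (2 * Q - A)) = B * C * (A ^ 4 * (2 * Q - A)) := by ring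
    have e2 : A ^ 2 * ((B + C - Q) ^ 2 * Q ^ 3) = (B + C - Q) ^ 2 * A ^ 2 * Q ^ 3 := by ring
    rw [e1, e2]
    calc B * C * (A ^ 4 * (2 * Q - A)) ≤ B * C * ((2 * A - Q) ^ 2 * Q ^ 3) := mul_le_mul_of_nonneg_left h2 hBC
      _ = B * C * (2 * A - Q) ^ 2 * Q ^ 3 := by ring
      _ ≤ (B + C - Q) ^ 2 * A ^ 2 * Q ^ 3 := by nlinarith [mul_le_mul_of_nonneg_right h1 (pow_nonneg hQ 3)]
  have h4 : A ^ 2 * B * C * (2 * Q - A) ≤ (B + C - Q) ^ 2 * Q ^ 3 := le_of_mul_le_mul_left h3 (pow_pos hApos 2)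
  have h5 : Q ^ 3 * (2 * Q - A) ≤ Q ^ 3 * (B + C - Q) ^ 2 := by nlinarith [mul_le_mul_of_nonneg_right hK hneg.le]
  exact le_of_mul_le_mul_left h5 (pow_pos hQpos 3)

/-- Case `B = min(A,B,C)`. [this work] -/
theorem threePoint_of_isoK_minB {Q A B C : ℝ} (hQ : 0 ≤ Q) (hQB : Q ≤ B) (hBA : B ≤ A) (hBC : B ≤ C)
    (hK : Q ^ 3 ≤ A * B ^ 2 * C) : 2 * Q - A ≤ (B + C - Q) ^ 2 := by
  by_cases hneg : 2 * Q - A ≤ 0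
  · exact hneg.trans (sq_nonneg _)
  push Not at hneg
  have hQpos : 0 < Q := by
    rcases hQ.eq_or_lt with h | h
    · exfalso; rw [← h] at hneg hQB; linarith
    · exact h
  have hBpos : 0 < B := hQpos.trans_le hQB
  have h1 := sq_bound_of_min hQ hQB le_rfl hBC
  have h2 := quintic_bound hQ hQB
  have hC : 0 ≤ C := hBpos.le.trans hBC
  -- `B² · [C B³ (2Q−B)] ≤ B² · [(B+C−Q)² Q³]`
  have h3 : B ^ 2 * (C * B ^ 3 * (2 * Q - B)) ≤ B ^ 2 * ((B + C - Q) ^ 2 * Q ^ 3) := by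
    have e1 : B ^ 2 * (C * B ^ 3 * (2 * Q - B)) = B * C * (B ^ 4 * (2 * Q - B)) := by ring
    have e2 : B ^ 2 * ((B + C - Q) ^ 2 * Q ^ 3) = (B + C - Q) ^ 2 * B ^ 2 * Q ^ 3 := by ring
    rw [e1, e2]
    calc B * C * (B ^ 4 * (2 * Q - B)) ≤ B * C * ((2 * B - Q) ^ 2 * Q ^ 3) :=
          mul_le_mul_of_nonneg_left h2 (mul_nonneg hBpos.le hC)
      _ = B * C * (2 * B - Q) ^ 2 * Q ^ 3 := by ring
      _ ≤ (B + C - Q) ^ 2 * B ^ 2 * Q ^ 3 := by nlinarith [mul_le_mul_of_nonneg_right h1 (pow_nonneg hQ 3)]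
  have h4 : C * B ^ 3 * (2 * Q - B) ≤ (B + C - Q) ^ 2 * Q ^ 3 := le_of_mul_le_mul_left h3 (pow_pos hBpos 2)
  -- `z ↦ z(2Q−z)` is decreasing on `[Q, ∞)`: `A(2Q−A) ≤ B(2Q−B)`
  have h5 : A * (2 * Q - A) ≤ B * (2 * Q - B) := by nlinarith [mul_nonneg (sub_nonneg.2 hBA) (by linarith : (0:ℝ) ≤ A + B - 2 * Q)]
  have h6 : A * B ^ 2 * C * (2 * Q - A) ≤ C * B ^ 3 * (2 * Q - B) := by
    have e1 : A * B ^ 2 * C * (2 * Q - A) = B ^ 2 * C * (A * (2 * Q - A)) := by ring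
    have e2 : C * B ^ 3 * (2 * Q - B) = B ^ 2 * C * (B * (2 * Q - B)) := by ring
    rw [e1, e2]
    exact mul_le_mul_of_nonneg_left h5 (mul_nonneg (sq_nonneg B) hC)
  have h7 : Q ^ 3 * (2 * Q - A) ≤ Q ^ 3 * (B + C - Q) ^ 2 := by nlinarith [mul_le_mul_of_nonneg_right hK hneg.le]
  exact le_of_mul_le_mul_left h7 (pow_pos hQpos 3)

/-- **`(K) ⟹ (3PT)` in isolation coordinates**: for reals `0 ≤ Q ≤ A, B, C` with `Q³ ≤ A²BC`, `Q³ ≤ AB²C`, `Q³ ≤ ABC²`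
(equivalently `A·B·C·min(A,B,C) ≥ Q³`), `2Q − A ≤ (B + C − Q)²`. [this work] -/
theorem threePoint_of_isoK {Q A B C : ℝ} (hQ : 0 ≤ Q) (hQA : Q ≤ A) (hQB : Q ≤ B) (hQC : Q ≤ C)
    (hKA : Q ^ 3 ≤ A ^ 2 * B * C) (hKB : Q ^ 3 ≤ A * B ^ 2 * C) (hKC : Q ^ 3 ≤ A * B * C ^ 2) :
    2 * Q - A ≤ (B + C - Q) ^ 2 := by
  rcases le_total A B with hAB | hBA
  · rcases le_total A C with hAC | hCA
    · exact threePoint_of_isoK_minA hQ hQA hAB hAC hKA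
    · -- `C ≤ A ≤ B`: `C` is the minimum
      have h := threePoint_of_isoK_minB (A := A) (B := C) (C := B) hQ hQC hCA (hCA.trans hAB) (by nlinarith [hKC])
      rwa [add_comm C B] at h
  · rcases le_total B C with hBC | hCB
    · exact threePoint_of_isoK_minB hQ hQB hBA hBC hKB
    · have h := threePoint_of_isoK_minB (A := A) (B := C) (C := B) hQ hQC (hCB.trans hBA) hCB (by nlinarith [hKC])
      rwa [add_comm C B] at h

/-! ## `(K)` for a single hub -/

section star
variable {α β γ : ℝ}

/-- `P(sep)` of one hub joined to `a, b, c` with probabilities `α, β, γ` (at most one of the three edges open). [this work] -/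
theorem star_Q_eq (α β γ : ℝ) : 1 - α * β - α * γ - β * γ + 2 * α * β * γ =
    (1 - α) * (1 - β) * (1 - γ) + α * (1 - β) * (1 - γ) + (1 - α) * β * (1 - γ) + (1 - α) * (1 - β) * γ := by ring

/-- `P(sep) ≥ 0` for a hub. [this work] -/
theorem star_Q_nonneg (hα : 0 ≤ α) (hα1 : α ≤ 1) (hβ : 0 ≤ β) (hβ1 : β ≤ 1) (hγ : 0 ≤ γ) (hγ1 : γ ≤ 1) :
    0 ≤ 1 - α * β - α * γ - β * γ + 2 * α * β * γ := by
  rw [star_Q_eq]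
  have := sub_nonneg.2 hα1; have := sub_nonneg.2 hβ1; have := sub_nonneg.2 hγ1
  positivity

/-- `P(sep) ≤ P(c isolated)` for a hub (`A − Q = P(ab|c) = αβ(1−γ)`). [this work] -/
theorem star_Q_le_A (hα : 0 ≤ α) (hβ : 0 ≤ β) (hγ1 : γ ≤ 1) :
    1 - α * β - α * γ - β * γ + 2 * α * β * γ ≤ 1 - γ * (α + β - α * β) := by
  nlinarith [mul_nonneg (mul_nonneg hα hβ) (sub_nonneg.2 hγ1)]

/-- `P(sep) ≤ P(b isolated)` for a hub. [this work] -/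
theorem star_Q_le_B (hα : 0 ≤ α) (hγ : 0 ≤ γ) (hβ1 : β ≤ 1) :
    1 - α * β - α * γ - β * γ + 2 * α * β * γ ≤ 1 - β * (α + γ - α * γ) := by
  nlinarith [mul_nonneg (mul_nonneg hα hγ) (sub_nonneg.2 hβ1)]

/-- `P(sep) ≤ P(a isolated)` for a hub. [this work] -/
theorem star_Q_le_C (hβ : 0 ≤ β) (hγ : 0 ≤ γ) (hα1 : α ≤ 1) :
    1 - α * β - α * γ - β * γ + 2 * α * β * γ ≤ 1 - α * (β + γ - β * γ) := by
  nlinarith [mul_nonneg (mul_nonneg hβ hγ) (sub_nonneg.2 hα1)]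

/-- **`ABC² ≥ Q³` for a hub** — the identity
`ABC² − Q³ = Q²βγ(1−α)[(1−α)(1−β)(1−γ) + β + γ − 2βγ] + Q²u² + Q(2stu + su² + tu²) + stu²`
with `s = αβ(1−γ)`, `t = αγ(1−β)`, `u = βγ(1−α)`. [this work] -/
theorem star_isoK_C (hα : 0 ≤ α) (hα1 : α ≤ 1) (hβ : 0 ≤ β) (hβ1 : β ≤ 1) (hγ : 0 ≤ γ) (hγ1 : γ ≤ 1) :
    (1 - α * β - α * γ - β * γ + 2 * α * β * γ) ^ 3 ≤
      (1 - γ * (α + β - α * β)) * (1 - β * (α + γ - α * γ)) * (1 - α * (β + γ - β * γ)) ^ 2 := by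
  have hQ := star_Q_nonneg hα hα1 hβ hβ1 hγ hγ1
  set Q := 1 - α * β - α * γ - β * γ + 2 * α * β * γ with hQdef
  have ha := sub_nonneg.2 hα1; have hb := sub_nonneg.2 hβ1; have hc := sub_nonneg.2 hγ1
  have hs : 0 ≤ α * β * (1 - γ) := by positivity
  have ht : 0 ≤ α * γ * (1 - β) := by positivity
  have hu : 0 ≤ β * γ * (1 - α) := by positivity
  have hσ : 0 ≤ β + γ - 2 * β * γ := by nlinarith [mul_nonneg hβ hc, mul_nonneg hγ hb]
  have key : (1 - γ * (α + β - α * β)) * (1 - β * (α + γ - α * γ)) * (1 - α * (β + γ - β * γ)) ^ 2 - Q ^ 3 =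
      Q ^ 2 * (β * γ * (1 - α)) * ((1 - α) * (1 - β) * (1 - γ) + (β + γ - 2 * β * γ)) + Q ^ 2 * (β * γ * (1 - α)) ^ 2 +
        Q * (2 * (α * β * (1 - γ)) * (α * γ * (1 - β)) * (β * γ * (1 - α)) + (α * β * (1 - γ)) * (β * γ * (1 - α)) ^ 2 +
          (α * γ * (1 - β)) * (β * γ * (1 - α)) ^ 2) + (α * β * (1 - γ)) * (α * γ * (1 - β)) * (β * γ * (1 - α)) ^ 2 := by
    rw [hQdef]; ring
  have t1 : 0 ≤ Q ^ 2 * (β * γ * (1 - α)) * ((1 - α) * (1 - β) * (1 - γ) + (β + γ - 2 * β * γ)) := by positivity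
  have t2 : 0 ≤ Q ^ 2 * (β * γ * (1 - α)) ^ 2 := by positivity
  have t3 : 0 ≤ Q * (2 * (α * β * (1 - γ)) * (α * γ * (1 - β)) * (β * γ * (1 - α)) + (α * β * (1 - γ)) * (β * γ * (1 - α)) ^ 2 +
      (α * γ * (1 - β)) * (β * γ * (1 - α)) ^ 2) := by positivity
  have t4 : 0 ≤ (α * β * (1 - γ)) * (α * γ * (1 - β)) * (β * γ * (1 - α)) ^ 2 := by positivity
  linarith [key, t1, t2, t3, t4]

/-- **`AB²C ≥ Q³` for a hub** (the `α ↔ β` image of `star_isoK_C`). [this work] -/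
theorem star_isoK_B (hα : 0 ≤ α) (hα1 : α ≤ 1) (hβ : 0 ≤ β) (hβ1 : β ≤ 1) (hγ : 0 ≤ γ) (hγ1 : γ ≤ 1) :
    (1 - α * β - α * γ - β * γ + 2 * α * β * γ) ^ 3 ≤
      (1 - γ * (α + β - α * β)) * (1 - β * (α + γ - α * γ)) ^ 2 * (1 - α * (β + γ - β * γ)) := by
  have h := star_isoK_C hβ hβ1 hα hα1 hγ hγ1
  have e1 : 1 - β * α - β * γ - α * γ + 2 * β * α * γ = 1 - α * β - α * γ - β * γ + 2 * α * β * γ := by ring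
  have e2 : (1 - γ * (β + α - β * α)) * (1 - α * (β + γ - β * γ)) * (1 - β * (α + γ - α * γ)) ^ 2 =
      (1 - γ * (α + β - α * β)) * (1 - β * (α + γ - α * γ)) ^ 2 * (1 - α * (β + γ - β * γ)) := by ring
  rw [e1, e2] at h
  exact h

/-- **`A²BC ≥ Q³` for a hub** (the `α ↔ γ` image of `star_isoK_C`). [this work] -/
theorem star_isoK_A (hα : 0 ≤ α) (hα1 : α ≤ 1) (hβ : 0 ≤ β) (hβ1 : β ≤ 1) (hγ : 0 ≤ γ) (hγ1 : γ ≤ 1) :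
    (1 - α * β - α * γ - β * γ + 2 * α * β * γ) ^ 3 ≤
      (1 - γ * (α + β - α * β)) ^ 2 * (1 - β * (α + γ - α * γ)) * (1 - α * (β + γ - β * γ)) := by
  have h := star_isoK_C hγ hγ1 hβ hβ1 hα hα1
  have e1 : 1 - γ * β - γ * α - β * α + 2 * γ * β * α = 1 - α * β - α * γ - β * γ + 2 * α * β * γ := by ring
  have e2 : (1 - α * (γ + β - γ * β)) * (1 - β * (γ + α - γ * α)) * (1 - γ * (β + α - β * α)) ^ 2 =
      (1 - γ * (α + β - α * β)) ^ 2 * (1 - β * (α + γ - α * γ)) * (1 - α * (β + γ - β * γ)) := by ring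
  rw [e1, e2] at h
  exact h

end star

/-! ## Products -/

section products
variable {ι : Type*} (S : Finset ι) (Q A B C : ι → ℝ)

/-- **`(K)` is closed under coordinatewise products** (one of the three inequalities; the others by renaming). [this work] -/
theorem isoK_prod (hQ : ∀ i ∈ S, 0 ≤ Q i) (hK : ∀ i ∈ S, Q i ^ 3 ≤ A i ^ 2 * B i * C i) :
    (∏ i ∈ S, Q i) ^ 3 ≤ (∏ i ∈ S, A i) ^ 2 * (∏ i ∈ S, B i) * ∏ i ∈ S, C i := by
  rw [← Finset.prod_pow, ← Finset.prod_pow, ← Finset.prod_mul_distrib, ← Finset.prod_mul_distrib]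
  exact Finset.prod_le_prod (fun i hi => pow_nonneg (hQ i hi) 3) hK

/-- **`(3PT)` for products of `(K)`-pieces**: if every factor satisfies `0 ≤ Qᵢ ≤ Aᵢ, Bᵢ, Cᵢ` and `(K)`, the product law satisfies
`2Q − A ≤ (B + C − Q)²`. [this work] -/
theorem threePoint_isoKProd (hQ : ∀ i ∈ S, 0 ≤ Q i) (hQA : ∀ i ∈ S, Q i ≤ A i) (hQB : ∀ i ∈ S, Q i ≤ B i)
    (hQC : ∀ i ∈ S, Q i ≤ C i) (hKA : ∀ i ∈ S, Q i ^ 3 ≤ A i ^ 2 * B i * C i) (hKB : ∀ i ∈ S, Q i ^ 3 ≤ A i * B i ^ 2 * C i)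
    (hKC : ∀ i ∈ S, Q i ^ 3 ≤ A i * B i * C i ^ 2) :
    2 * (∏ i ∈ S, Q i) - ∏ i ∈ S, A i ≤ ((∏ i ∈ S, B i) + (∏ i ∈ S, C i) - ∏ i ∈ S, Q i) ^ 2 := by
  refine threePoint_of_isoK (Finset.prod_nonneg hQ) (Finset.prod_le_prod hQ hQA) (Finset.prod_le_prod hQ hQB)
    (Finset.prod_le_prod hQ hQC) (isoK_prod S Q A B C hQ hKA) ?_ ?_
  · have h := isoK_prod S Q B A C hQ fun i hi => (hKB i hi).trans_eq (by ring)
    exact h.trans_eq (by ring)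
  · have h := isoK_prod S Q C A B hQ fun i hi => (hKC i hi).trans_eq (by ring)
    exact h.trans_eq (by ring)

end products

/-! ## `(3PT)` for hub laws -/

section hub
variable {ι : Type*} (S : Finset ι) (α β γ : ι → ℝ)

/-- **The three-point variance row for every hub law.**  For a finite family of hubs `i ∈ S` joined to `a, b, c` with probabilities
`α i, β i, γ i ∈ [0,1]`, let `Q, A, B, C` be the products of the single-hub isolation probabilities (= `P(sep)`, `P(c isolated)`,
`P(b isolated)`, `P(a isolated)` of `K_{3,S}`, by independence of the hubs' edge triples).  Then `2Q − A ≤ (B + C − Q)²`, i.e.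
(`threePoint_cells`) `P(a↔b)P(a↮b) ≤ P(ab|c) + P(ac|b) + P(bc|a)` for the law of `K_{3,S}` with arbitrary weights. [this work] -/
theorem threePoint_hubLaw (h01 : ∀ i ∈ S, 0 ≤ α i ∧ α i ≤ 1 ∧ 0 ≤ β i ∧ β i ≤ 1 ∧ 0 ≤ γ i ∧ γ i ≤ 1) :
    2 * (∏ i ∈ S, (1 - α i * β i - α i * γ i - β i * γ i + 2 * α i * β i * γ i)) -
        ∏ i ∈ S, (1 - γ i * (α i + β i - α i * β i)) ≤
      ((∏ i ∈ S, (1 - β i * (α i + γ i - α i * γ i))) + (∏ i ∈ S, (1 - α i * (β i + γ i - β i * γ i))) -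
          ∏ i ∈ S, (1 - α i * β i - α i * γ i - β i * γ i + 2 * α i * β i * γ i)) ^ 2 := by
  refine threePoint_isoKProd S (fun i => 1 - α i * β i - α i * γ i - β i * γ i + 2 * α i * β i * γ i)
    (fun i => 1 - γ i * (α i + β i - α i * β i)) (fun i => 1 - β i * (α i + γ i - α i * γ i))
    (fun i => 1 - α i * (β i + γ i - β i * γ i)) ?_ ?_ ?_ ?_ ?_ ?_ ?_ <;> intro i hi <;> obtain ⟨h1, h2, h3, h4, h5, h6⟩ := h01 i hi
  · exact star_Q_nonneg h1 h2 h3 h4 h5 h6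
  · exact star_Q_le_A h1 h3 h6
  · exact star_Q_le_B h1 h5 h4
  · exact star_Q_le_C h3 h5 h2
  · exact star_isoK_A h1 h2 h3 h4 h5 h6
  · exact star_isoK_B h1 h2 h3 h4 h5 h6
  · exact star_isoK_C h1 h2 h3 h4 h5 h6

end hub

end Summit.CriticalPhenomena.PercolationContinuityZ3.Theorems.ThreePointIsoProduct
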